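import Summits.Ventures.HodgeRepro2.T5IsotypicStep4Product
import Summits.Ventures.HodgeRepro2.T5IsotypicDimensionBoundInvariants

/-!
# T5IsotypicDimensionBoundProduct — STEPS 4 + 5 for `G(𝔸) = G_∞ × G(𝔸_f)` with the canonical
isotypic parts: «π₀ ⊂ L_{π_∞}» and «dim π₀^{K_f}[τ] ≤ m_{K_f}(π_∞) · dim (H_{π_∞})_τ < ∞»

Cell pub-hodge-repro2, seat p5, Tier 5 (route/T5-N4-p5.md, N4.3 v13 (A3) STEPS 4–5, l. 147).  The
two kernel statements of rows 85 and 82 in the shape of the application: the big group is the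
product `A × B` («G_∞ × G(𝔸_f)»), the isotypic parts are the CANONICAL ones (closed spans of all
closed stable copies of `σ π`, row 79's `isotypicPart`), the decomposition `S` of `Fx` («L^{K_f}») is
that of the `A`-action, and `K` («K_∞») acts through `κ : K →* A`.

* `canonH`: the canonical copies as an indexed family (index type: the copies themselves), with
  `closure_iSup_canonH : closure (⨆ i, canonH … π i) = isotypicPart (ρ.comp inl) (σ π)`;
* `membersCanon`, `members_canonH_eq`: «S_π» for the canonical parts;
* `stable_of_restrict`: a subspace carrying a restriction of `ρ` is `ρ`-stable;
* **`existsUnique_le_isotypicPart`**: STEP 4 (row 85) — a closed `ρ`-irreducible `W₀ ≠ ⊥` lies in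
  exactly one canonical isotypic part;
* **`finite_and_finrank_isotypicComponent_inf_le`**: STEP 5 (row 82) for that `π` — the
  `T`-isotypic part of `W₀ ⊓ Fx` («π₀^{K_f}») is finite-dimensional of dimension at most
  `#S_π · dim_ℂ H_π[T]`, given `H_π[T]` finite-dimensional (admissibility of `π_∞`).

Imports rows 85 / 82 (and rows 76–80 / 79 through them).  Axioms: propext, Classical.choice,
Quot.sound.  README §8(d): uses an L-value-free non-vanishing device: NO.
-/

namespace Summit.Ventures.HodgeRepro2.T5IsotypicDimensionBoundProduct

open scoped InnerProductSpace
open Summit.Ventures.HodgeRepro2.T5CompactDiscreteDecomposition (IrreducibleOn)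
open Summit.Ventures.HodgeRepro2.T5FiniteMultiplicity (IsUnitaryEquiv)
open Summit.Ventures.HodgeRepro2.T5FiniteCopiesModule (toRep)
open Summit.Ventures.HodgeRepro2.T5IsotypicStep4Adelic (copies isotypicPart isotypicPart_eq)
open Summit.Ventures.HodgeRepro2.T5IsotypicStep4Product (existsUnique_le_isotypicPart_prod)
open Summit.Ventures.HodgeRepro2.T5IsotypicDimensionBound (members sumRep)
open Summit.Ventures.HodgeRepro2.T5IsotypicDimensionBoundInvariants (toKSubmodule inf_stable)

variable {E : Type*} [NormedAddCommGroup E] [InnerProductSpace ℂ E] [CompleteSpace E]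
variable {A B : Type*} [Group A] [Group B]
variable {P : Type*} {F : P → Type*} [∀ π, NormedAddCommGroup (F π)]
  [∀ π, InnerProductSpace ℂ (F π)] [∀ π, CompleteSpace (F π)]

omit [CompleteSpace E] [∀ π, CompleteSpace (F π)] in
/-- The canonical copies of `σ π` (row 79's `copies`) as an indexed family of subspaces. -/
def canonH (ρA : A →* (E →L[ℂ] E)) (σ : ∀ π, A →* (F π →L[ℂ] F π)) (π : P)
    (W : copies ρA (σ π)) : Submodule ℂ E :=
  (W : Submodule ℂ E)

omit [CompleteSpace E] [∀ π, CompleteSpace (F π)] in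
/-- The closed span of the canonical copies is the canonical isotypic part. -/
theorem closure_iSup_canonH (ρA : A →* (E →L[ℂ] E)) (σ : ∀ π, A →* (F π →L[ℂ] F π)) (π : P) :
    (⨆ i, canonH ρA σ π i).topologicalClosure = isotypicPart ρA (σ π) :=
  (isotypicPart_eq ρA (σ π)).symm

omit [CompleteSpace E] [∀ π, CompleteSpace (F π)] in
/-- «S_π» for the canonical isotypic parts: the members of `S` lying in `isotypicPart ρA (σ π)`. -/
theorem members_canonH_eq (ρA : A →* (E →L[ℂ] E)) (σ : ∀ π, A →* (F π →L[ℂ] F π))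
    (S : Set (Submodule ℂ E)) (π : P) :
    members S (canonH ρA σ) π = {W ∈ S | W ≤ isotypicPart ρA (σ π)} := by
  unfold members
  rw [closure_iSup_canonH]

omit [CompleteSpace E] in
/-- A subspace carrying a restriction `ρW₀` of `ρ` is `ρ`-stable. -/
theorem stable_of_restrict {G : Type*} [Group G] {ρ : G →* (E →L[ℂ] E)} {W₀ : Submodule ℂ E}
    (ρW₀ : G →* (W₀ →L[ℂ] W₀)) (hρW₀ : ∀ g (w : W₀), (ρW₀ g w : E) = ρ g w) (g : G) :
    ∀ x ∈ W₀, ρ g x ∈ W₀ := by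
  intro x hx
  have h := (ρW₀ g ⟨x, hx⟩).2
  rwa [hρW₀] at h

/-- **STEP 4 for the product group and the canonical isotypic parts** (row 85): a closed
`ρ`-irreducible `W₀ ≠ ⊥` lies in exactly one canonical `A`-isotypic part. -/
theorem existsUnique_le_isotypicPart {ρ : A × B →* (E →L[ℂ] E)} (hρ : ∀ g, star (ρ g) = ρ g⁻¹)
    (σ : ∀ π, A →* (F π →L[ℂ] F π)) (hσ : ∀ π a, star (σ π a) = σ π a⁻¹)
    (hσirr : ∀ π, ∀ V : Submodule ℂ (F π), IsClosed (V : Set (F π)) →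
      (∀ a, ∀ v ∈ V, σ π a v ∈ V) → V = ⊥ ∨ V = ⊤)
    (hne : ∀ π π', π ≠ π' → ∀ V : F π ≃ₗᵢ[ℂ] F π', ¬ ∀ a x, V (σ π a x) = σ π' a (V x))
    (hdense : (⨆ π, isotypicPart (ρ.comp (MonoidHom.inl A B)) (σ π)).topologicalClosure = ⊤)
    {W₀ : Submodule ℂ E} (hW₀c : IsClosed (W₀ : Set E)) (hW₀0 : W₀ ≠ ⊥)
    (ρW₀ : A × B →* (W₀ →L[ℂ] W₀)) (hρW₀ : ∀ g (w : W₀), (ρW₀ g w : E) = ρ g w)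
    (hW₀irr : ∀ C : Submodule ℂ W₀, IsClosed (C : Set W₀) →
      (∀ g, ∀ x ∈ C, ρW₀ g x ∈ C) → C = ⊥ ∨ C = ⊤) :
    ∃! π, W₀ ≤ isotypicPart (ρ.comp (MonoidHom.inl A B)) (σ π) :=
  existsUnique_le_isotypicPart_prod hρ σ hσ hσirr hne hdense hW₀c hW₀0 ρW₀ hρW₀ hW₀irr

/-- **STEP 5 for the product group and the canonical isotypic parts** (row 82): for the `π` with
`W₀ ≤ L_π` and a simple `ℂ[K]`-module `T` with `H_π[T]` finite-dimensional, the `T`-isotypic part of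
`W₀ ⊓ Fx` («π₀^{K_f}», as a `ℂ[K]`-submodule of `L_π ⊓ Fx`, all of it) is finite-dimensional of
dimension at most `#S_π · dim_ℂ H_π[T]` (`S_π = members S (canonH …) π = {W ∈ S | W ≤ L_π}`,
`members_canonH_eq`). -/
theorem finite_and_finrank_isotypicComponent_inf_le {ρ : A × B →* (E →L[ℂ] E)}
    (hρ : ∀ g, star (ρ g) = ρ g⁻¹)
    (σ : ∀ π, A →* (F π →L[ℂ] F π)) (hσ : ∀ π a, star (σ π a) = σ π a⁻¹)
    (hσirr : ∀ π, ∀ V : Submodule ℂ (F π), IsClosed (V : Set (F π)) →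
      (∀ a, ∀ v ∈ V, σ π a v ∈ V) → V = ⊥ ∨ V = ⊤)
    (hne : ∀ π π', π ≠ π' → ∀ V : F π ≃ₗᵢ[ℂ] F π', ¬ ∀ a x, V (σ π a x) = σ π' a (V x))
    (hdense : (⨆ π, isotypicPart (ρ.comp (MonoidHom.inl A B)) (σ π)).topologicalClosure = ⊤)
    {Fx : Submodule ℂ E} {S : Set (Submodule ℂ E)}
    (hS : ∀ W ∈ S, IrreducibleOn (ρ.comp (MonoidHom.inl A B)) W)
    (hSo : S.Pairwise (fun W W' => W ⟂ W')) (hSd : (sSup S).topologicalClosure = Fx)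
    (hfin : ∀ W₀ ∈ S, {W ∈ S | IsUnitaryEquiv (ρ.comp (MonoidHom.inl A B)) W₀ W}.Finite)
    (π : P) [Nontrivial (F π)] {W₀ : Submodule ℂ E}
    (ρW₀ : A × B →* (W₀ →L[ℂ] W₀)) (hρW₀ : ∀ g (w : W₀), (ρW₀ g w : E) = ρ g w)
    (hπ : W₀ ≤ isotypicPart (ρ.comp (MonoidHom.inl A B)) (σ π))
    {K : Type*} [Group K] (κ : K →* A)
    (T : Type*) [AddCommGroup T] [Module (MonoidAlgebra ℂ K) T]
    [IsSimpleModule (MonoidAlgebra ℂ K) T]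
    [Module.Finite ℂ (isotypicComponent (MonoidAlgebra ℂ K) (toRep ((σ π).comp κ)).asModule T)] :
    (∀ x ∈ W₀ ⊓ Fx, ∃ y ∈ toKSubmodule κ hS (canonH (ρ.comp (MonoidHom.inl A B)) σ) π (W₀ ⊓ Fx)
      (inf_stable (MonoidHom.inl A B) κ hS hSd (stable_of_restrict ρW₀ hρW₀)),
      ((sumRep κ hS (canonH (ρ.comp (MonoidHom.inl A B)) σ) π).asModuleEquiv y : E) = x) ∧
    Module.Finite ℂ (isotypicComponent (MonoidAlgebra ℂ K)
      (toKSubmodule κ hS (canonH (ρ.comp (MonoidHom.inl A B)) σ) π (W₀ ⊓ Fx)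
        (inf_stable (MonoidHom.inl A B) κ hS hSd (stable_of_restrict ρW₀ hρW₀))) T) ∧
    Module.finrank ℂ (isotypicComponent (MonoidAlgebra ℂ K)
      (toKSubmodule κ hS (canonH (ρ.comp (MonoidHom.inl A B)) σ) π (W₀ ⊓ Fx)
        (inf_stable (MonoidHom.inl A B) κ hS hSd (stable_of_restrict ρW₀ hρW₀))) T) ≤
      Nat.card (members S (canonH (ρ.comp (MonoidHom.inl A B)) σ) π) *
        Module.finrank ℂ (isotypicComponent (MonoidAlgebra ℂ K) (toRep ((σ π).comp κ)).asModule T) := by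
  have hdense' : (⨆ π, (⨆ i, canonH (ρ.comp (MonoidHom.inl A B)) σ π i).topologicalClosure).topologicalClosure = ⊤ := by
    simp only [closure_iSup_canonH]
    exact hdense
  have hπ' : W₀ ≤ (⨆ i, canonH (ρ.comp (MonoidHom.inl A B)) σ π i).topologicalClosure := by
    rw [closure_iSup_canonH]
    exact hπ
  have key := T5IsotypicDimensionBoundInvariants.finite_and_finrank_isotypicComponent_inf_le hρ
    (MonoidHom.inl A B) σ hσ hσirr hne
    (canonH (ρ.comp (MonoidHom.inl A B)) σ) (fun π W => W.2.1) (fun π W a => W.2.2.1 a)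
    (fun π W => Classical.choose W.2.2.2) (fun π W => Classical.choose_spec W.2.2.2)
    hdense' hS hSo hSd hfin π (stable_of_restrict ρW₀ hρW₀) hπ' κ T
  exact key

end Summit.Ventures.HodgeRepro2.T5IsotypicDimensionBoundProduct
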